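import Summits.BirchSwinnertonDyer.Rank1Residual.Additive.X3BranchLayerTwoZeta27
import HarnessLib

/-!
# X3, the DEGENERATE rows OFF the sub-locus, LAYER TWO: `θ₂ = ζ₂₇ + ζ₂₇⁻¹` lies in the second layer
# `ℚ_2` of every cyclotomic `ℤ₃`-extension of `ℚ`, satisfies the nonic `t⁹ − 9t⁷ + 27t⁵ − 30t³ + 9t + 1 = 0`,
# and `Γ_ℚ` moves it to `θ₂² − 2` (cell `bsd-eis`, seat `bsd-eis-x3` gen 8; first brick of the U-side over
# the second layer `ℚ_2 = ℚ(ζ₂₇)⁺` needed by the 12 live rows with some `s_ℓ ≥ 9` (x3-MEMO-10 §5); the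
# layer-`2` analogue of k5-c3's `Iwasawa/CyclotomicLayerOneCubic.lean`; route K1 `AdditiveBranchIMC`,
# crux `GordTwoRankZeroOffCaseOne` — supports only)

HONEST FRAMING (`run/shared/lean/pub/bsd-eis/README.md` §4): THEOREMS ONLY (no `def`, no named fact,
no `sorry`); nothing is booked; no label, tier or count of record moves.

* `smul_theta27_eq` — `σ ∈ κ_cyc⁻¹(9ℤ₃)` fixes `ζ + ζ²⁶` (`ζ²⁷ = 1`; gen 7's `smul_eq_or_eq_pow_26`);
* `zeta_add_pow_mem_layer_two` — `ζ + ζ²⁶ ∈ κ.layer 2` for every cyclotomic `κ` (unit twists);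
* `theta27_nonic` — for a primitive `27`-th root of unity `ζ`, `θ₂ = ζ + ζ²⁶` satisfies
  `θ₂⁹ − 9θ₂⁷ + 27θ₂⁵ − 30θ₂³ + 9θ₂ + 1 = 0` (from `θ₁ = θ₂³ − 3θ₂` and k5-c3's cubic `θ₁³ − 3θ₁ + 1 = 0`);
* `exists_smul_theta27_eq_sq_sub_two` — some `τ ∈ Γ_ℚ` (`χ₃(τ) ≡ 2 (mod 27)`) maps `θ₂ ↦ θ₂² − 2`
  (a generator of `Gal(ℚ_2/ℚ) ≅ ℤ/9`: `2` generates `(ℤ/27)ˣ/±1`).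
References: [Washington1997] §2, §13.1; [Serre1973] Ch. II §3.2.
-/

set_option autoImplicit false

noncomputable section

namespace Summit.BirchSwinnertonDyer.Rank1Residual.Additive

namespace LayerTwoField

open Field IntermediateField
open Literature.NumberTheory.GaloisRepresentations
open Literature.NumberTheory.EllipticCurves Literature.NumberTheory.EllipticCurves.CyclotomicZp
open Summit.BirchSwinnertonDyer.Rank1Residual.Iwasawa.CyclotomicLayerOne

/-- For `σ ∈ κ_cyc⁻¹(9ℤ₃)`, `σ` fixes `θ₂ = ζ + ζ²⁶` (`ζ²⁷ = 1`). [cite: Washington1997, §13.1] -/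
theorem smul_theta27_eq {σ : absoluteGaloisGroup ℚ} (hσ : σ ∈ (zpExtension 3).layerSubgroup 2)
    (ζ : AlgebraicClosure ℚ) (hζ : ζ ^ 27 = 1) : σ • (ζ + ζ ^ 26) = ζ + ζ ^ 26 := by
  rw [smul_add, smul_pow']
  rcases LayerCharTower.smul_eq_or_eq_pow_26 hσ ζ hζ with h | h
  · rw [h]
  · rw [h, ← pow_mul, show 26 * 26 = 27 * 25 + 1 by norm_num, pow_add, pow_mul, hζ, one_pow,
      one_mul, pow_one, add_comm]

/-- **`ζ + ζ²⁶ ∈ κ.layer 2`** for every cyclotomic `κ : ZpExtension ℚ 3` and every `ζ` with `ζ²⁷ = 1`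
(`κ = κ_cyc.unitTwist u`, `layer_unitTwist`). [cite: Washington1997, §13.1] -/
theorem zeta_add_pow_mem_layer_two {κ : ZpExtension ℚ 3} (hκ : κ.IsCyclotomic)
    (ζ : AlgebraicClosure ℚ) (hζ : ζ ^ 27 = 1) : ζ + ζ ^ 26 ∈ κ.layer 2 := by
  obtain ⟨u, rfl⟩ := ZpExtension.IsCyclotomic.exists_eq_unitTwist_holds (isCyclotomic_zpExtension 3) hκ
  rw [ZpExtension.layer_unitTwist, ZpExtension.layer, IntermediateField.mem_fixedField_iff]
  intro g hg
  obtain ⟨σ, hσ, rfl⟩ := Subgroup.mem_map.mp hg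
  exact smul_theta27_eq hσ ζ hζ

/-- `θ₁ = θ₂³ − 3θ₂`: `ζ³ + ζ²⁴ = (ζ + ζ²⁶)³ − 3(ζ + ζ²⁶)` for `ζ²⁷ = 1`. [folklore] -/
theorem theta9_eq_of_theta27 {F : Type*} [Field F] {ζ : F} (hζ : ζ ^ 27 = 1) :
    ζ ^ 3 + (ζ ^ 3) ^ 8 = (ζ + ζ ^ 26) ^ 3 - 3 * (ζ + ζ ^ 26) := by
  have h2 : (ζ ^ 3) ^ 8 = ζ ^ 24 := by ring
  rw [h2]
  linear_combination (-(ζ ^ 24) * ζ ^ 27 - ζ ^ 24 - 3 * (ζ + ζ ^ 26)) * hζ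

/-- **The nonic of `θ₂ = ζ₂₇ + ζ₂₇⁻¹`**: for a primitive `27`-th root of unity `ζ`,
`θ₂⁹ − 9θ₂⁷ + 27θ₂⁵ − 30θ₂³ + 9θ₂ + 1 = 0` — substitute `θ₁ = θ₂³ − 3θ₂` into k5-c3's
`θ₁³ − 3θ₁ + 1 = 0` (`theta_cubic` for the primitive `9`-th root `ζ³`). [cite: Washington1997, §2] -/
theorem theta27_nonic {F : Type*} [Field F] {ζ : F} (hζ : IsPrimitiveRoot ζ 27) :
    (ζ + ζ ^ 26) ^ 9 - 9 * (ζ + ζ ^ 26) ^ 7 + 27 * (ζ + ζ ^ 26) ^ 5 - 30 * (ζ + ζ ^ 26) ^ 3 +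
      9 * (ζ + ζ ^ 26) + 1 = 0 := by
  have hζ9 : IsPrimitiveRoot (ζ ^ 3) 9 := hζ.pow (by norm_num) (by norm_num)
  have hc := theta_cubic hζ9
  rw [theta9_eq_of_theta27 hζ.pow_eq_one] at hc
  linear_combination hc

/-- **`Γ_ℚ` moves `θ₂` to `θ₂² − 2`**: an automorphism `τ` with `χ₃(τ) ≡ 2 (mod 27)` maps
`ζ ↦ ζ²`, hence `ζ + ζ²⁶ ↦ ζ² + ζ²⁵ = (ζ + ζ²⁶)² − 2`. [cite: Washington1997, §13.1] -/
theorem exists_smul_theta27_eq_sq_sub_two (ζ : AlgebraicClosure ℚ) (hζ : ζ ^ 27 = 1) :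
    ∃ τ : absoluteGaloisGroup ℚ, τ • (ζ + ζ ^ 26) = (ζ + ζ ^ 26) ^ 2 - 2 := by
  haveI : NeZero ((3 : ℕ) : ℚ) := ⟨by norm_num⟩
  obtain ⟨τ, hτ⟩ := GaloisRep.exists_cyclotomicCharacter_toZModPow_eq (p := 3) 3 2 (by norm_num)
  refine ⟨τ, ?_⟩
  have hspec := GaloisRep.cyclotomicCharacter_spec ℚ 3 (k := 3) τ ζ (by simpa using hζ)
  have hval : (PadicInt.toZModPow 3 ((GaloisRep.cyclotomicCharacter ℚ 3 τ : ℤ_[3]ˣ) : ℤ_[3])).val = 2 := by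
    rw [hτ]; decide
  rw [hval] at hspec
  rw [smul_add, smul_pow', hspec]
  have h52 : (ζ ^ 2) ^ 26 = ζ ^ 25 * ζ ^ 27 := by ring
  rw [h52, hζ, mul_one]
  linear_combination (-(ζ ^ 25) - 2) * hζ

end LayerTwoField

end Summit.BirchSwinnertonDyer.Rank1Residual.Additive

end
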